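import Summits.CriticalPhenomena.PercolationContinuityZ3.Theorems.SahiMasterFamilyPhiOrbitUpperSevenR
import Summits.CriticalPhenomena.PercolationContinuityZ3.Theorems.SahiMasterFamilyPhiOrbitUpperSevenD1
import Summits.CriticalPhenomena.PercolationContinuityZ3.Theorems.SahiMasterFamilyPhiOrbitUpperSevenD2
import Summits.CriticalPhenomena.PercolationContinuityZ3.Theorems.SahiMasterFamilyUpperMasterEvents

/-!
# `U(7)` holds: `Φ_7(β) ≤ 6!·(β_⊤ − ∏β_i)` for nonnegative supermultiplicative `β`, and the upper master inequality for `7` increasing events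

Unit `prim-masterthm-p4` (gen 13; crux anchor stmt-CriticalPhenomena-4575, helper work; memo
`run/shared/lean/prim/prim-masterthm/prim-masterthm-p4/P4-GEN13-REPORT.md` §6, §10).  Assembly of the orbit-basis pieces `…PhiOrbitUpperSevenR/D1/D2`
through `PhiCert.phiLeTopGap_of_orbitPiecesU` (certificate kit j124718).
* `phiLeTopGap_seven : UpperMaster.PhiLeTopGap 7` (kernel, standard axioms).
* `sahiE_seven_ind_le_top_gap` — for every finite product of two-point spaces and every 7 increasing events,
  `E_7(μ_p; 1_U) ≤ 6!·(μ_p(⋂U_j) − ∏μ_p(U_j))` (transfer `UpperMaster.sahiE_ind_le_top_gap_of_phiLeTopGap`).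
HONEST FRAMING: an UPPER bound; Sahi's `C_7` (lower bound) is open in general. [this work]
-/

set_option autoImplicit false

namespace Summit.CriticalPhenomena.PercolationContinuityZ3.Theorems

namespace PhiCert

open Literature.Combinatorics.Sahi2008
open Literature.Probability.Percolation.DecisionTree (ind)

/-- **`U(7)`** (`PhiLeTopGap 7`), kernel theorem via the orbit-basis certificate check. [compute j124718] [this work] -/
theorem phiLeTopGap_seven : UpperMaster.PhiLeTopGap 7 :=
  phiLeTopGap_of_orbitPiecesU 6 1 (by norm_num) _ _ _ (by decide) dataDU_seven normRU_seven reconDU_seven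

/-- **The upper master inequality for `7` increasing events**: `E_7(μ_p; 1_U) ≤ 6!·(μ_p(⋂ U_j) − ∏ μ_p(U_j))`. [this work] -/
theorem sahiE_seven_ind_le_top_gap {ι : Type} [Fintype ι] (p : ι → unitInterval) (U : Fin 7 → Set (Set ι))
    (hU : ∀ j, IsUpperSet (U j)) :
    sahiE (bernoulliWeight p) 7 (fun j => ind (U j)) ≤
      (Nat.factorial 6 : ℝ) * (ex (bernoulliWeight p) (ind (⋂ j, U j)) - ∏ j, ex (bernoulliWeight p) (ind (U j))) :=
  UpperMaster.sahiE_ind_le_top_gap_of_phiLeTopGap phiLeTopGap_seven p U hU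

end PhiCert

end Summit.CriticalPhenomena.PercolationContinuityZ3.Theorems
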